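import Mathlib
import HarnessLib
import Literature.Computability.AlgebraicComplexity.FlatteningRank
import Literature.Computability.AlgebraicComplexity.AsymptoticSpectrumProofs
import Literature.Computability.AlgebraicComplexity.AlmanLi2026SpectrumMatMul
import Summits.MatrixMultiplication.MatrixMultiplication.Theorems.OutsiderSandwichExchangeExponent
import Summits.MatrixMultiplication.MatrixMultiplication.Theorems.OutsiderSandwichTraceDefect

/-!
# Outsider sandwich — the SYMMETRIC CORE of the coupled block and ENTANGLEMENT FORCING
# (decomp-mm lens-4, g23)

Lens «minimal-counterexample / extremal reduction», generation 23, supporting item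
`stmt-MatrixMultiplication-27147` (`Theses.OutsiderSandwich.BlockOneIsMM`, the ω-free leaf
`∀ universal F, F⟨2,2,2⟩ ≤ F(C₁)`, equivalently `θ⋆ = 0` for the exchange exponent of g20; the cut of
record `LaserTangency ∧ LaserMergeOptimal` is UNCHANGED by this file).

By g22 the coupled Coppersmith–Winograd block `C₁ ≅ (A; u, w) ↦ (Au, Aᵀw)` and
`⟨2,2,2⟩ ≅ (A; u, w) ↦ (Au, Aw)` differ by ONE letter (the transpose, i.e. the sign of the antisymmetric
coordinate `t = A₀₁ − A₁₀`).  This file isolates their COMMON PART and proves it is too weak, so that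
near-optimal certificates for the leaf must use the antisymmetric letter:

* the **symmetric core** `P := (S; u, w) ↦ (Su, Sw)`, `S` a symmetric `2 × 2` matrix (format
  `3 × 4 × 4`; `symCore`, defined as the fibre sum of `pairTensor 2` over the weight `r + c` of the
  matrix position) is a common restriction of both tensors: **`C₁ ≥ P`** and **`⟨2,2,2⟩ ≥ P`**
  (`coupling₁_restrictsTo_symCore`, `matMul_restrictsTo_symCore`) — restricting the matrix argument to
  symmetric matrices kills the only letter in which the two tensors differ;
* the **first-leg floor for ANY helper** (`helpedBy_floor₁`): a restriction
  `⟨B⟩ ⊠ H^{⊠N} ≥ ⟨2,2,2⟩^{⊠N}` forces `4^N ≤ B · |ι|^N`, `ι` the first index type of `H` — the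
  flattening rank `ζ⁽¹⁾` (a universal spectral point, CVZ Ex. 1.4) is `4^N` on the right and at most
  the number of slices on the left.  For `H = C₁` (`|ι| = 4`) the floor is void; for the symmetric core
  (`|ι| = 3`) it reads **`4^N ≤ B · 3^N`** (`symHelped_floor`): symmetric-core ("fibre") certificates
  have rate **`≥ log₂(4/3) = 0.415…`** (`logb_le_of_symExponentAchieved`), and `ζ⁽¹⁾` is a KNOWN
  separating point for the pair `(⟨2,2,2⟩, P)` (`exists_point_lt_symCore`: the leaf's analogue for `P`
  is FALSE), whereas no catalogued point separates `(⟨2,2,2⟩, C₁)`;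
* **entanglement forcing** (`forcing`): since `θ⋆ ≤ 0.37295 < 2/5 < log₂(4/3)` (tree:
  `exchangeExponent_le_leGall`, Le Gall's bound on `ω` through the laser floor), cofinally many levels
  `N` carry certificates `⟨B⟩ ⊠ C₁^{⊠N} ≥ ⟨2,2,2⟩^{⊠N}` with **`B · 3^N < 4^N`** — fewer helpers than ANY
  symmetric-core certificate needs at that level; in particular `¬ SymHelped N B` for them.  The
  advantage of `C₁` over its core (`exchangeExponent_lt_of_symExponentAchieved`) is antisymmetric;
* the **mixed floor** (`mixed_floor`): symmetrising `a` of `a + b` factors already costs `(4/3)^a`;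
* small levels (`not_symHelped_table`): no symmetric-core certificate at `(N, B) ∈ {(1,1), (2,1),
  (3,2), (4,3), (5,4), (8,9)}` — a `(3,2)` certificate (census plateau `√(80/512)` = the fibre deficit
  `√((4³ − 2·3³)/4³)`), if it exists, is entangled.

All statements are explicit restrictions / counting; no `sorry`, no new axioms.
-/

noncomputable section

open Literature.Computability.AlgebraicComplexity
open Summit.MatrixMultiplication.MatrixMultiplication.Theorems.OutsiderSandwichCoupling (coupling₁)
open Summit.MatrixMultiplication.MatrixMultiplication.Theorems.OutsiderSandwichBlockNormalForm
  (pairTensor pairTensor_restrictsTo_coupling₁ coupling₁_restrictsTo_pairTensor)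
open Summit.MatrixMultiplication.MatrixMultiplication.Theorems.OutsiderSandwichGluingGain
  (uHalf wHalf pairTensor_eq_add)
open Summit.MatrixMultiplication.MatrixMultiplication.Theorems.OutsiderSandwichTraceDefect
  (mmPair wPlain mmPair_two_restrictsTo_matMul matMul_restrictsTo_mmPair_two)
open Summit.MatrixMultiplication.MatrixMultiplication.Theorems.OutsiderSandwichExchangeRate (Helped)
open Summit.MatrixMultiplication.MatrixMultiplication.Theorems.OutsiderSandwichExchangeExponent
  (exchangeExponent exponentAchieved_of_gt_leGall exchangeExponent_le_leGall exchangeExponent_le)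

namespace Summit.MatrixMultiplication.MatrixMultiplication.Theorems.OutsiderSandwichSymmetricCore

/-! ## 0. One restriction tool: fibre sums along the first leg -/
section Tools

variable {K : Type} [CommSemiring K] {ι κ μ ι' : Type} [Fintype ι] [Fintype κ] [Fintype μ]
  [DecidableEq κ] [DecidableEq μ] [DecidableEq ι']

/-- **Fibre sums along a map of the first leg are restrictions**: `t ≥ (∑_{a : f a = a'} t a b c)`
(first-leg matrix the `0/1` incidence matrix of `f`, identities on the other legs; substituting one
variable for all variables of a fibre). [cite: Blaser2013, Def. 7.2] -/
theorem tensorRestrictsTo_fibreSum (t : ι → κ → μ → K) (f : ι → ι') :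
    TensorRestrictsTo t (fun a' b c => ∑ a, if f a = a' then t a b c else 0) := by
  refine ⟨fun a' a => if f a = a' then 1 else 0, fun b' b => if b' = b then 1 else 0,
    fun c' c => if c' = c then 1 else 0, fun a' b' c' => ?_⟩
  refine Finset.sum_congr rfl fun a _ => ?_
  rw [Finset.sum_eq_single b' (fun b _ hb => by simp [Ne.symm hb]) (by simp),
    Finset.sum_eq_single c' (fun c _ hc => by simp [Ne.symm hc]) (by simp)]
  by_cases h : f a = a' <;> simp [h]

end Tools

/-! ## 1. The first-leg floor for an arbitrary helper -/
section Floor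

variable {ι κ μ : Type} [Fintype ι] [Fintype κ] [Fintype μ]

omit [Fintype κ] [Fintype μ] in
/-- `ζ⁽¹⁾(t) ≤ |ι|`: the flattening rank is at most the number of slices. [cite: ChristandlVranaZuiddam2023, Example 1.4] -/
theorem flatteningRank_le_card (t : ι → κ → μ → ℂ) : flatteningRank t ≤ Fintype.card ι := by
  unfold flatteningRank
  exact finrank_range_le_card _

/-- `ζ⁽¹⁾(⟨2,2,2⟩) = 4`. [cite: ChristandlVranaZuiddam2023, Example 1.4] -/
theorem flatteningRank_matMul_two : flatteningRank (matMulTensor ℂ 2 2 2) = 4 := by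
  have h := gaugePoint₁_matMulTensor (K := ℂ) (k := 2) (m := 2) (n := 2) two_pos
  rw [gaugePoint₁_eq] at h
  exact_mod_cast h

/-- **`HelpedBy H N B`**: `⟨B⟩ ⊠ H^{⊠N} ≥ ⟨2,2,2⟩^{⊠N}` — `B` disjoint copies of the `N`-th Kronecker
power of the helper `H` restrict to the `N`-th power of `2 × 2` matrix multiplication (g20's `Helped`
is the case `H = C₁`). [cite: Strassen1988, Thm. 3.8] -/
def HelpedBy (H : ι → κ → μ → ℂ) (N B : ℕ) : Prop :=
  TensorRestrictsTo (kroneckerTensor (unitTensor ℂ B) (kroneckerPow H N))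
    (kroneckerPow (matMulTensor ℂ 2 2 2) N)

/-- `HelpedBy C₁ = Helped` (definitionally). [cite: Strassen1988, Thm. 3.8] -/
theorem helpedBy_coupling₁_iff (N B : ℕ) : HelpedBy coupling₁ N B ↔ Helped N B := Iff.rfl

/-- **The first-leg floor**: `⟨B⟩ ⊠ H^{⊠N} ≥ ⟨2,2,2⟩^{⊠N}` forces `4^N ≤ B · |ι|^N`
(`ζ⁽¹⁾` is monotone under restriction, multiplicative, `= 4` on `⟨2,2,2⟩`, `≤ #slices`).
[cite: ChristandlVranaZuiddam2023, Example 1.4] -/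
theorem helpedBy_floor₁ {H : ι → κ → μ → ℂ} {N B : ℕ} (h : HelpedBy H N B) :
    4 ^ N ≤ B * Fintype.card ι ^ N := by
  classical
  have h₁ := flatteningRank_mono h
  rw [flatteningRank_kroneckerPow, flatteningRank_matMul_two] at h₁
  refine h₁.trans ((flatteningRank_le_card _).trans (le_of_eq ?_))
  simp only [Fintype.card_prod, Fintype.card_fin, Fintype.card_fun]

/-- A better helper helps at least as well: `H' ≥ H` and `HelpedBy H N B` give `HelpedBy H' N B`.
[cite: BurgisserClausenShokrollahi1997, Prop. 15.25] -/
theorem HelpedBy.of_restrictsTo [DecidableEq ι] [DecidableEq κ] [DecidableEq μ]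
    {ι' κ' μ' : Type} [Fintype ι'] [Fintype κ'] [Fintype μ'] [DecidableEq ι'] [DecidableEq κ']
    [DecidableEq μ'] {H : ι → κ → μ → ℂ} {H' : ι' → κ' → μ' → ℂ} {N B : ℕ}
    (hH : TensorRestrictsTo H' H) (h : HelpedBy H N B) : HelpedBy H' N B :=
  (((TensorRestrictsTo.refl (unitTensor ℂ B)).kronecker (hH.kroneckerPow N))).trans h

end Floor

/-! ## 2. The symmetric core `P = (S; u, w) ↦ (Su, Sw)` -/

/-- The weight `r + c ∈ {0, 1, 2}` of a matrix position `(r, c)`: the three classes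
`{(0,0)}, {(0,1), (1,0)}, {(1,1)}` index the entries `s₀, s₁, s₂` of a symmetric `2 × 2` matrix.
[folklore] -/
def symWt (a : Fin 2 × Fin 2) : Fin 3 :=
  ⟨a.1.val + a.2.val, by have := a.1.isLt; have := a.2.isLt; omega⟩

/-- The weight is symmetric under transposition. [folklore] -/
theorem symWt_swap (a : Fin 2 × Fin 2) : symWt a.swap = symWt a := by
  ext
  simp [symWt, Nat.add_comm]

/-- **The symmetric core `P`** (format `3 × 4 × 4`): the pair tensor `(A; u, w) ↦ (Au, Aᵀw)` with the
matrix argument restricted to SYMMETRIC matrices `S` (`s_{r+c} := A_{rc}`), i.e. `(S; u, w) ↦ (Su, Sw)`;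
formally the fibre sum of `pairTensor 2` over `symWt`. [cite: ChristandlVranaZuiddam2023, §1.1] -/
def symCore : Fin 3 → Fin 2 × Fin 2 → Fin 2 × Fin 2 → ℂ :=
  fun p y z => ∑ a : Fin 2 × Fin 2, if symWt a = p then pairTensor 2 a y z else 0

/-- `pairTensor 2 ≥ P`. [cite: Blaser2013, Def. 7.2] -/
theorem pairTensor_restrictsTo_symCore : TensorRestrictsTo (pairTensor 2) symCore :=
  tensorRestrictsTo_fibreSum (pairTensor 2) symWt

/-- **`C₁ ≥ P`**: the coupled block restricts to its symmetric core. [cite: Blaser2013, Def. 7.2] -/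
theorem coupling₁_restrictsTo_symCore : TensorRestrictsTo coupling₁ symCore :=
  coupling₁_restrictsTo_pairTensor.trans pairTensor_restrictsTo_symCore

/-- The plain slot is the transposed slot read at the transposed position:
`wPlain n a = wHalf n aᵀ`. [folklore] -/
theorem wPlain_eq_wHalf_swap (n : ℕ) (a : Fin n × Fin n) (y z : Fin 2 × Fin n) :
    wPlain n a y z = wHalf n a.swap y z := by
  obtain ⟨a₁, a₂⟩ := a
  rfl

/-- **On symmetric matrices `Aᵀw = Aw`**: the symmetric core is ALSO the fibre sum of
`mmPair 2 ≅ ⟨2,2,2⟩` over `symWt`. [folklore] -/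
theorem symCore_eq_fibreSum_mmPair :
    symCore = fun p y z => ∑ a : Fin 2 × Fin 2, if symWt a = p then mmPair 2 a y z else 0 := by
  funext p y z
  have key : (∑ a : Fin 2 × Fin 2, if symWt a = p then wPlain 2 a y z else 0) =
      ∑ a : Fin 2 × Fin 2, if symWt a = p then wHalf 2 a y z else 0 := by
    calc (∑ a : Fin 2 × Fin 2, if symWt a = p then wPlain 2 a y z else 0)
        = ∑ a : Fin 2 × Fin 2, (fun a' : Fin 2 × Fin 2 =>
            if symWt a' = p then wHalf 2 a' y z else 0) (Equiv.prodComm (Fin 2) (Fin 2) a) := by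
          refine Finset.sum_congr rfl fun a _ => ?_
          simp only [Equiv.prodComm_apply, symWt_swap, wPlain_eq_wHalf_swap]
      _ = ∑ a : Fin 2 × Fin 2, if symWt a = p then wHalf 2 a y z else 0 :=
          Equiv.sum_comp (Equiv.prodComm (Fin 2) (Fin 2))
            (fun a' : Fin 2 × Fin 2 => if symWt a' = p then wHalf 2 a' y z else 0)
  simp only [symCore, pairTensor_eq_add, mmPair, Pi.add_apply]
  calc (∑ a : Fin 2 × Fin 2, if symWt a = p then uHalf 2 a y z + wHalf 2 a y z else 0)
      = (∑ a : Fin 2 × Fin 2, if symWt a = p then uHalf 2 a y z else 0) +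
          ∑ a : Fin 2 × Fin 2, if symWt a = p then wHalf 2 a y z else 0 := by
        rw [← Finset.sum_add_distrib]
        exact Finset.sum_congr rfl fun a _ => by split_ifs <;> simp
    _ = (∑ a : Fin 2 × Fin 2, if symWt a = p then uHalf 2 a y z else 0) +
          ∑ a : Fin 2 × Fin 2, if symWt a = p then wPlain 2 a y z else 0 := by rw [key]
    _ = ∑ a : Fin 2 × Fin 2, if symWt a = p then uHalf 2 a y z + wPlain 2 a y z else 0 := by
        rw [← Finset.sum_add_distrib]
        exact Finset.sum_congr rfl fun a _ => by split_ifs <;> simp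

/-- `mmPair 2 ≥ P`. [cite: Blaser2013, Def. 7.2] -/
theorem mmPair_restrictsTo_symCore : TensorRestrictsTo (mmPair 2) symCore := by
  rw [symCore_eq_fibreSum_mmPair]
  exact tensorRestrictsTo_fibreSum (mmPair 2) symWt

/-- **`⟨2,2,2⟩ ≥ P`**: `2 × 2` matrix multiplication restricts to the symmetric core too — `P` is a
COMMON core of the leaf's two tensors. [cite: Blaser2013, §5 (the tensor ⟨k,m,n⟩)] -/
theorem matMul_restrictsTo_symCore : TensorRestrictsTo (matMulTensor ℂ 2 2 2) symCore :=
  matMul_restrictsTo_mmPair_two.trans mmPair_restrictsTo_symCore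

/-- `ζ⁽¹⁾(P) ≤ 3` (three slices). [cite: ChristandlVranaZuiddam2023, Example 1.4] -/
theorem flatteningRank_symCore_le : flatteningRank symCore ≤ 3 := by
  simpa using flatteningRank_le_card symCore

/-- **The first gauge point separates `⟨2,2,2⟩` from the core**: `ζ⁽¹⁾(P) ≤ 3 < 4 = ζ⁽¹⁾⟨2,2,2⟩` —
the leaf's analogue for `P` is FALSE with a KNOWN minimal counterexample. [cite: ChristandlVranaZuiddam2023, Example 1.4] -/
theorem exists_point_lt_symCore :
    ∃ F : SpectralMap ℂ, IsUniversalSpectralPoint ℂ F ∧ F symCore < F (matMulTensor ℂ 2 2 2) := by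
  refine ⟨gaugePoint₁ ℂ, gaugePoint₁_isUniversalSpectralPoint ℂ, ?_⟩
  rw [gaugePoint₁_eq, gaugePoint₁_eq, flatteningRank_matMul_two]
  have h := flatteningRank_symCore_le
  exact_mod_cast Nat.lt_of_le_of_lt h (by norm_num)

/-- Hence **`P ≵ ⟨2,2,2⟩`**: the core's analogue of `BlockOneIsMM` fails. [cite: Strassen1988, Thm. 3.8] -/
theorem not_forall_point_matMul_le_symCore :
    ¬ ∀ F : SpectralMap ℂ, IsUniversalSpectralPoint ℂ F → F (matMulTensor ℂ 2 2 2) ≤ F symCore := by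
  intro h
  obtain ⟨F, hF, hlt⟩ := exists_point_lt_symCore
  exact absurd (h F hF) (not_le.2 hlt)

/-! ## 3. Symmetric-core certificates: the floor `4^N ≤ B · 3^N` -/

/-- **`SymHelped N B`**: `⟨B⟩ ⊠ P^{⊠N} ≥ ⟨2,2,2⟩^{⊠N}` — a certificate for the leaf that factors
through the symmetric core (a "fibre" certificate). [cite: Strassen1988, Thm. 3.8] -/
def SymHelped (N B : ℕ) : Prop :=
  HelpedBy symCore N B

/-- A symmetric-core certificate is a certificate: `SymHelped N B → Helped N B` (`C₁ ≥ P`).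
[cite: BurgisserClausenShokrollahi1997, Prop. 15.25] -/
theorem helped_of_symHelped {N B : ℕ} (h : SymHelped N B) : Helped N B :=
  (helpedBy_coupling₁_iff N B).1 (HelpedBy.of_restrictsTo coupling₁_restrictsTo_symCore h)

/-- **The floor**: `SymHelped N B → 4^N ≤ B · 3^N` — a fibre certificate needs at least `(4/3)^N`
helpers. [cite: ChristandlVranaZuiddam2023, Example 1.4] -/
theorem symHelped_floor {N B : ℕ} (h : SymHelped N B) : 4 ^ N ≤ B * 3 ^ N := by
  simpa using helpedBy_floor₁ h

/-- Below the floor there is no fibre certificate. [cite: ChristandlVranaZuiddam2023, Example 1.4] -/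
theorem not_symHelped_of_lt {N B : ℕ} (h : B * 3 ^ N < 4 ^ N) : ¬ SymHelped N B := fun hs =>
  absurd (symHelped_floor hs) (not_le.2 h)

/-- **Small levels**: no symmetric-core certificate at `(N,B) = (1,1), (2,1), (3,2), (4,3), (5,4),
(8,9)`; in particular the census's `(3,2)` regime (`2 · 27 = 54 < 64`) is unreachable by the core.
[cite: ChristandlVranaZuiddam2023, Example 1.4] -/
theorem not_symHelped_table :
    ¬ SymHelped 1 1 ∧ ¬ SymHelped 2 1 ∧ ¬ SymHelped 3 2 ∧ ¬ SymHelped 4 3 ∧ ¬ SymHelped 5 4 ∧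
      ¬ SymHelped 8 9 :=
  ⟨not_symHelped_of_lt (by norm_num), not_symHelped_of_lt (by norm_num),
    not_symHelped_of_lt (by norm_num), not_symHelped_of_lt (by norm_num),
    not_symHelped_of_lt (by norm_num), not_symHelped_of_lt (by norm_num)⟩

/-- **The mixed floor**: a certificate using the symmetric core in `a` of the `a + b` Kronecker factors
and the full block in the other `b` needs `4^a ≤ B · 3^a` — symmetrising `a` factors costs `(4/3)^a`
helpers whatever the other factors do (`ζ⁽¹⁾(C₁) ≤ 4`). [cite: ChristandlVranaZuiddam2023, Example 1.4] -/
theorem mixed_floor {a b B : ℕ}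
    (h : TensorRestrictsTo
      (kroneckerTensor (unitTensor ℂ B) (kroneckerTensor (kroneckerPow symCore a)
        (kroneckerPow coupling₁ b)))
      (kroneckerPow (matMulTensor ℂ 2 2 2) (a + b))) :
    4 ^ a ≤ B * 3 ^ a := by
  have h₁ := flatteningRank_mono h
  rw [flatteningRank_kroneckerPow, flatteningRank_matMul_two, pow_add] at h₁
  have h₂ := flatteningRank_le_card (kroneckerTensor (unitTensor ℂ B)
    (kroneckerTensor (kroneckerPow symCore a) (kroneckerPow coupling₁ b)))
  simp only [Fintype.card_prod, Fintype.card_fin, Fintype.card_fun] at h₂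
  have h₃ : 4 ^ a * 4 ^ b ≤ B * 3 ^ a * 4 ^ b := by
    calc 4 ^ a * 4 ^ b ≤ B * (3 ^ a * 4 ^ b) := h₁.trans h₂
      _ = B * 3 ^ a * 4 ^ b := by ring
  exact Nat.le_of_mul_le_mul_right h₃ (by positivity)

/-! ## 4. Rates: the fibre rate is at least `log₂(4/3)`, the block's rate is below `2/5` -/

/-- **`SymExponentAchieved θ`**: cofinally in `N`, some `B ≤ 2^{θN}` copies of the CORE help
(the fibre analogue of g20's `ExponentAchieved`). [cite: Strassen1988, Thm. 3.8] -/
def SymExponentAchieved (θ : ℝ) : Prop :=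
  ∀ N₀ : ℕ, ∃ N : ℕ, N₀ ≤ N ∧ ∃ B : ℕ, SymHelped N B ∧ (B : ℝ) ≤ (2 : ℝ) ^ (θ * N)

/-- A fibre rate is a rate: `SymExponentAchieved θ → ExponentAchieved θ`. [cite: Strassen1988, Thm. 3.8] -/
theorem exponentAchieved_of_symExponentAchieved {θ : ℝ} (h : SymExponentAchieved θ) :
    OutsiderSandwichExchangeRate.ExponentAchieved θ := fun N₀ =>
  let ⟨N, hN, B, hB, hle⟩ := h N₀; ⟨N, hN, B, helped_of_symHelped hB, hle⟩

/-- The floor in multiplicative form: a fibre certificate with `B ≤ (2^θ)^N` copies at a level `N ≥ 1`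
forces `4/3 ≤ 2^θ`. [cite: ChristandlVranaZuiddam2023, Example 1.4] -/
theorem four_thirds_le_of_symHelped {N B : ℕ} {θ : ℝ} (hN : 1 ≤ N) (h : SymHelped N B)
    (hle : (B : ℝ) ≤ (2 : ℝ) ^ (θ * N)) : (4 : ℝ) / 3 ≤ (2 : ℝ) ^ θ := by
  by_contra hlt
  push Not at hlt
  rw [Real.rpow_mul_natCast (by norm_num : (0 : ℝ) ≤ 2)] at hle
  have hfloor : (4 : ℝ) ^ N ≤ (B : ℝ) * 3 ^ N := by exact_mod_cast symHelped_floor h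
  have hpow : ((2 : ℝ) ^ θ) ^ N < ((4 : ℝ) / 3) ^ N :=
    pow_lt_pow_left₀ hlt (by positivity) (by omega)
  have key : (4 : ℝ) ^ N < 4 ^ N :=
    calc (4 : ℝ) ^ N ≤ (B : ℝ) * 3 ^ N := hfloor
      _ ≤ ((2 : ℝ) ^ θ) ^ N * 3 ^ N := mul_le_mul_of_nonneg_right hle (by positivity)
      _ < ((4 : ℝ) / 3) ^ N * 3 ^ N := mul_lt_mul_of_pos_right hpow (by positivity)
      _ = 4 ^ N := by rw [← mul_pow]; norm_num
  exact lt_irrefl _ key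

/-- **The fibre rate floor**: `SymExponentAchieved θ → log₂(4/3) ≤ θ` (`log₂(4/3) = 0.4150…`).
[cite: ChristandlVranaZuiddam2023, Example 1.4] -/
theorem logb_le_of_symExponentAchieved {θ : ℝ} (h : SymExponentAchieved θ) :
    Real.logb 2 (4 / 3) ≤ θ := by
  obtain ⟨N, hN, B, hB, hle⟩ := h 1
  have h43 : (4 : ℝ) / 3 ≤ (2 : ℝ) ^ θ := four_thirds_le_of_symHelped hN hB hle
  by_contra hlt
  push Not at hlt
  have h' : (2 : ℝ) ^ θ < (2 : ℝ) ^ Real.logb 2 (4 / 3) :=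
    (Real.rpow_lt_rpow_left_iff one_lt_two).2 hlt
  rw [Real.rpow_logb (by norm_num) (by norm_num) (by norm_num)] at h'
  exact absurd h43 (not_le.2 h')

/-- `2^{2/5} < 4/3` (since `(2^{2/5})^5 = 4 < 1024/243 = (4/3)^5`). [folklore] -/
theorem two_rpow_two_fifths_lt : (2 : ℝ) ^ ((2 : ℝ) / 5) < 4 / 3 := by
  by_contra h
  push Not at h
  have h5 : ((4 : ℝ) / 3) ^ 5 ≤ ((2 : ℝ) ^ ((2 : ℝ) / 5)) ^ 5 := pow_le_pow_left₀ (by norm_num) h 5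
  rw [← Real.rpow_mul_natCast (by norm_num : (0 : ℝ) ≤ 2),
    show ((2 : ℝ) / 5 * ((5 : ℕ) : ℝ)) = ((2 : ℕ) : ℝ) by norm_num, Real.rpow_natCast] at h5
  norm_num at h5

/-- `2/5 < log₂(4/3)`. [folklore] -/
theorem two_fifths_lt_logb : (2 : ℝ) / 5 < Real.logb 2 (4 / 3) := by
  have h : (2 : ℝ) ^ ((2 : ℝ) / 5) < (2 : ℝ) ^ Real.logb 2 (4 / 3) := by
    rw [Real.rpow_logb (by norm_num) (by norm_num) (by norm_num)]
    exact two_rpow_two_fifths_lt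
  exact (Real.rpow_lt_rpow_left_iff one_lt_two).1 h

/-- **`θ⋆ < 2/5`**: the block's exchange exponent is below `2/5` (tree: `θ⋆ ≤ 0.37295`, Le Gall).
[cite: LeGall2014, Table 2] -/
theorem exchangeExponent_lt_two_fifths : exchangeExponent < 2 / 5 :=
  lt_of_le_of_lt exchangeExponent_le_leGall (by norm_num)

/-- **The block beats its core**: every fibre rate `θ` satisfies `θ⋆(C₁) < 2/5 < log₂(4/3) ≤ θ`.
The whole advantage of `C₁` over `P` — at least `log₂(4/3) − 0.37295 > 0.042` in rate — is carried by
the antisymmetric letter. [cite: LeGall2014, Table 2] -/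
theorem exchangeExponent_lt_of_symExponentAchieved {θ : ℝ} (h : SymExponentAchieved θ) :
    exchangeExponent < θ :=
  (exchangeExponent_lt_two_fifths.trans two_fifths_lt_logb).trans_le (logb_le_of_symExponentAchieved h)

/-! ## 5. Entanglement forcing -/

/-- Rate-`2/5` help counts are below the fibre floor: `B ≤ 2^{2N/5}`, `N ≥ 1` ⇒ `B · 3^N < 4^N`.
[folklore] -/
theorem lt_floor_of_le_rpow {N B : ℕ} (hN : 1 ≤ N)
    (hle : (B : ℝ) ≤ (2 : ℝ) ^ ((2 : ℝ) / 5 * N)) : B * 3 ^ N < 4 ^ N := by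
  rw [Real.rpow_mul_natCast (by norm_num : (0 : ℝ) ≤ 2)] at hle
  have h1 : ((2 : ℝ) ^ ((2 : ℝ) / 5)) ^ N < ((4 : ℝ) / 3) ^ N :=
    pow_lt_pow_left₀ two_rpow_two_fifths_lt (by positivity) (by omega)
  have hlt : (B : ℝ) * 3 ^ N < 4 ^ N :=
    calc (B : ℝ) * 3 ^ N ≤ ((2 : ℝ) ^ ((2 : ℝ) / 5)) ^ N * 3 ^ N :=
          mul_le_mul_of_nonneg_right hle (by positivity)
      _ < ((4 : ℝ) / 3) ^ N * 3 ^ N := mul_lt_mul_of_pos_right h1 (by positivity)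
      _ = 4 ^ N := by rw [← mul_pow]; norm_num
  exact_mod_cast hlt

/-- **ENTANGLEMENT FORCING.**  Cofinally many levels `N` carry a certificate
`⟨B⟩ ⊠ C₁^{⊠N} ≥ ⟨2,2,2⟩^{⊠N}` with `B · 3^N < 4^N`, hence one that NO symmetric-core certificate matches
at that `(N, B)`: near-optimal certificates for the leaf must use the antisymmetric input letter
(non-constructive: Le Gall's `ω ≤ 2.3728639` through the laser floor `θ⋆ ≤ ω − 2`, at rate `2/5`).
[cite: LeGall2014, Table 2] -/
theorem forcing (N₀ : ℕ) :
    ∃ N : ℕ, N₀ ≤ N ∧ ∃ B : ℕ, Helped N B ∧ B * 3 ^ N < 4 ^ N ∧ ¬ SymHelped N B := by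
  obtain ⟨N, hN, B, hB, hle⟩ :=
    exponentAchieved_of_gt_leGall (θ := 2 / 5) (by norm_num) (max N₀ 1)
  have hlt := lt_floor_of_le_rpow ((le_max_right _ _).trans hN) hle
  exact ⟨N, (le_max_left _ _).trans hN, B, hB, hlt, not_symHelped_of_lt hlt⟩

/-- **Eventual form**: at ALL large levels there is a certificate strictly below the fibre floor
(tree: `eventually_helped_of_exchangeExponent_lt` at rate `2/5`). [cite: LeGall2014, Table 2] -/
theorem eventually_forcing :
    ∃ N₀ : ℕ, ∀ N : ℕ, N₀ ≤ N → ∃ B : ℕ, Helped N B ∧ B * 3 ^ N < 4 ^ N ∧ ¬ SymHelped N B := by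
  obtain ⟨N₀, hN₀⟩ :=
    OutsiderSandwichExchangeExponent.eventually_helped_of_exchangeExponent_lt
      exchangeExponent_lt_two_fifths
  refine ⟨max N₀ 1, fun N hN => ?_⟩
  obtain ⟨B, hB, hle⟩ := hN₀ N ((le_max_left _ _).trans hN)
  have hlt := lt_floor_of_le_rpow ((le_max_right _ _).trans hN) hle
  exact ⟨B, hB, hlt, not_symHelped_of_lt hlt⟩

/-- **The leaf, re-read through the core**: `BlockOneIsMM` says the antisymmetric letter repairs the
`4 : 3` flattening defect of the core at rate `0`; unconditionally it repairs it below the fibre rate: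
`θ⋆ < 2/5 < log₂(4/3)`, while `ζ⁽¹⁾` refutes the core's analogue of the leaf outright.
[cite: Strassen1988, Thm. 3.8] -/
theorem leaf_vs_core :
    (¬ ∀ F : SpectralMap ℂ, IsUniversalSpectralPoint ℂ F → F (matMulTensor ℂ 2 2 2) ≤ F symCore) ∧
      exchangeExponent < Real.logb 2 (4 / 3) ∧
      (Theses.OutsiderSandwich.BlockOneIsMM ↔ exchangeExponent = 0) :=
  ⟨not_forall_point_matMul_le_symCore, exchangeExponent_lt_two_fifths.trans two_fifths_lt_logb,
    OutsiderSandwichExchangeExponent.blockOneIsMM_iff_exchangeExponent_eq_zero⟩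

end Summit.MatrixMultiplication.MatrixMultiplication.Theorems.OutsiderSandwichSymmetricCore

end
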